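import Summits.QuantumFields.BalabanUV.T4Continuum.Support.CovariantDivergencePlantingBound

/-!
# T⁴ programme, spine node NE2 (U1a) — THE COVARIANT-DIVERGENCE PLANTING NUMBER ALONG THE TOWER (tier B, supplier row B4.f of
# `t4/formal/NE2/LEAVES.md`, third file): the two-level bound of `Support/CovariantDivergencePlantingBound` at the levels
# `η = L^{−k}`, `η′ = L^{−(k+1)}` of the King tower, in the exact shape of the field `LayerLaws.planting_le` of row B4.b

NE2 formalisation swarm `t4-ne2-formalise-*`, seat LEAF 10 (unit `b2b-balaban-t4-ne2-formalise-leaf-10`).  Row B4.b's layer bundle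
(`Support/GaugeTermLayer.LayerLaws`, leaf-05) asks, at every level `k`, for a number `θ k` with
`‖G′_{k+1}·((D_{k+1})ᴴ·(J_k ⊗ 1) − J₀_k·(D_k)ᴴ)·(Δ_a^{(k)} ⊗ 1)⁻¹‖ ≤ θ k` (the sandwiched covariant-divergence planting number), `J_k` King's
pairing `JpcT L M k`, `J₀_k` a 0-form planting.  With `J₀_k = JK0 (lev L k) L M ⊗ 1` (King's planting on colour 0-forms; `= ScalarBlockPlanting.JK0`
by `JK0_eq_planting`) the operator inside is LITERALLY `divPlant (lev L k) L M (R (k+1)) (R k)` of file 1, and `(Δ_a^{(k)} ⊗ 1)⁻¹ = 𝒢^{(k)} ⊗ 1`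
(`NE2ColourPerturbedLayer.inv_calDalev_kron`, not restated);
so file 2's `opNorm_sandwiched_divPlant_le` gives, for ANY left factor `Gs` with `‖Gs‖ ≤ g` and complement number
`‖Gs·((1 − Π₀) ⊗ 1)‖ ≤ c₀` (row B4.b's `ec k`; `JK0T`/`Pi0T` = `JK0`/`Pi0` retyped to consecutive tower levels like `JpcT`):

  **`planting_number_le`**: `θ k := c₀·d(L + 1)Cst + g·d(β′ + 2(α + β))Cst/L^k`

from the size `α`, the lattice-Lipschitz constant `β/L^k` and the two-level consistency `β′/L^k` (the B6 / NE3 currency) of the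
connection `w^{(k)} = L^k(R^{(k)} − 1)` — i.e. `θ` is GEOMETRIC (`O(L^{−k})`) as soon as `c₀ = ec k` is, which is what
`GaugeTermSandwichLaw.Esand_le_geometric` needs.  Also the tower forms of `‖D_kᴴ(𝒢 ⊗ 1)‖ ≤ dCst + dαCst`.

HONEST FRAMING (T4-DAG p. 1).  [folklore] re-indexing of file 2 along the tower, OURS; the only printed input is (1.89) through the tree's
kernel theorems; transporters and `Gs` are DATA (trigger c5); finite torus, linear layer, operator norm, model level; NOT [B9] (3.23)–(3.26)
as printed; NE2 NOT proved; NOT infinite volume / mass gap / Clay / summit progress; spine 0/9 unchanged.  HONEST DEPENDENCY: continuum YM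
on T⁴ ⇐ BetaPertH ∧ nine spine estimates (0/9 proved); BetaPertH ⇐ (D1) ∧ (D4) ∧ CAP+tail; G-an2-4 gates asym, D1 and NE2/3/4.  ABSOLUTE
RULE kept; no `sorry`.
-/

noncomputable section

open scoped BigOperators ComplexConjugate Matrix Matrix.Norms.L2Operator Kronecker

namespace Summit.QuantumFields.BalabanUV.T4Continuum.CovariantDivergencePlantingTower

open Literature.MathematicalPhysics.QuantumFieldTheory.Balaban1983to89.B5Prop11Plancherel
open Literature.MathematicalPhysics.QuantumFieldTheory.Balaban1983to89.B5G183RateUnitTower (lev lev_neZero)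
open Summit.QuantumFields.BalabanUV.T4Continuum
open Summit.QuantumFields.BalabanUV.T4Continuum.BalabanAveragedTowerUnit (idx calGlev one_le_lev' cast_lev' lev_succ')
open Summit.QuantumFields.BalabanUV.T4Continuum.KingPairingPlantedLaw (JK JpcT calDalev calDalev_inv JpcT_eq_JK)
open Summit.QuantumFields.BalabanUV.T4Continuum.BlockPairingGeometry (tau parT)
open Summit.QuantumFields.BalabanUV.T4Continuum.KroneckerLift
open Summit.QuantumFields.BalabanUV.T4Continuum.GaugeTermDecomposition
open Summit.QuantumFields.BalabanUV.T4Continuum.CovariantDivergencePlanting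
open Summit.QuantumFields.BalabanUV.T4Continuum.CovariantDivergencePlantingBound

variable {d : ℕ} (L : ℕ) [NeZero L] (M : Fin d → ℕ) [hM : ∀ μ, NeZero (M μ)] (a : ℝ) (ha : 0 < a)
  {o : Type*} [Fintype o] [DecidableEq o]

/-- King's 0-form planting RETYPED to consecutive tower levels (`lev L (k+1) = L·lev L k` definitionally; cures the instance search on
mixed `lev L (k+1)` / `L * lev L k` index types, exactly as `KingPairingPlantedLaw.JpcT` does for 1-forms). [folklore] -/
def JK0T (k : ℕ) : Matrix (Tor (fine (lev L (k + 1)) M)) (Tor (fine (lev L k) M)) ℂ := JK0 (lev L k) L M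

/-- the scalar block projection, retyped. [folklore] -/
def Pi0T (k : ℕ) : Matrix (Tor (fine (lev L (k + 1)) M)) (Tor (fine (lev L (k + 1)) M)) ℂ := Pi0 (lev L k) L M

omit [NeZero L] hM in
/-- `JK0T k = JK0 (lev L k) L M`. [folklore] -/
theorem JK0T_eq (k : ℕ) : JK0T L M k = JK0 (lev L k) L M := rfl

/-- `Pi0T k = Pi0 (lev L k) L M = JK0T k·(JK0T k)ᴴ`. [folklore] -/
theorem Pi0T_eq (k : ℕ) : Pi0T L M k = JK0T L M k * (JK0T L M k)ᴴ := rfl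

/-- **THE PLANTING NUMBER ALONG THE TOWER** (`d ≥ 1`): for a transporter tower `R` whose connection `w^{(k)} = L^k(R^{(k)} − 1)` has size
`≤ α`, lattice-Lipschitz constant `β/L^k` and two-level consistency `β′/L^k` at the block parent (the B6 / NE3 currency), and ANY left
factor `Gs` (DATA: row B4.b's `G′_{k+1}`) with `‖Gs‖ ≤ g` and complement number `‖Gs·((1 − Π₀) ⊗ 1)‖ ≤ c₀`:
`‖Gs·((D_{k+1})ᴴ(J_k ⊗ 1) − (J₀_k ⊗ 1)(D_k)ᴴ)·(Δ_a^{(k)} ⊗ 1)⁻¹‖ ≤ c₀·d(L + 1)Cst + g·d(β′ + 2(α + β))Cst/L^k` — the `θ k` of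
`GaugeTermLayer.LayerLaws.planting_le` for `J₀ k = JK0T L M k ⊗ₖ 1`; the operator inside is `divPlant (lev L k) L M (R (k+1)) (R k)`
definitionally. [cite: Balaban1984PropagatorsI, Prop. 1.1 (1.89) p.33; King1986, (2.10) p.653] [folklore] -/
theorem planting_number_le (hd : 1 ≤ d) (R : (k : ℕ) → Fin d → (Tor (fine (lev L k) M) → Matrix o o ℂ)) (k : ℕ)
    {α β β' g c₀ : ℝ} (hα : 0 ≤ α) (hβ : 0 ≤ β) (hβ' : 0 ≤ β') (hg : 0 ≤ g) (hc₀ : 0 ≤ c₀)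
    (hR : ∀ μ i, ‖connL (fine (lev L k) M) ((lev L k : ℕ) : ℂ) (R k) μ i‖ ≤ α)
    (hLip : ∀ μ lam i, ‖connL (fine (lev L k) M) ((lev L k : ℕ) : ℂ) (R k) μ (tau (fine (lev L k) M) lam i)
      - connL (fine (lev L k) M) ((lev L k : ℕ) : ℂ) (R k) μ i‖ ≤ β / (lev L k : ℕ))
    (hcons : ∀ μ (i' : Tor (fine (lev L (k + 1)) M) × Fin d),
      ‖connL (fine (lev L (k + 1)) M) ((lev L (k + 1) : ℕ) : ℂ) (R (k + 1)) μ i'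
        - connL (fine (lev L k) M) ((lev L k : ℕ) : ℂ) (R k) μ (parT (lev L k) L M i')‖ ≤ β' / (lev L k : ℕ))
    {γ' : Type*} [Fintype γ'] [DecidableEq γ'] {Gs : Matrix γ' (Tor (fine (lev L (k + 1)) M) × o) ℂ} (hGs : ‖Gs‖ ≤ g)
    (hcomp : ‖Gs * ((1 - Pi0T L M k) ⊗ₖ (1 : Matrix o o ℂ))‖ ≤ c₀) :
    ‖Gs * ((covGrad (fine (lev L (k + 1)) M) ((lev L (k + 1) : ℕ) : ℂ) (R (k + 1)))ᴴ * (JpcT L M k ⊗ₖ (1 : Matrix o o ℂ))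
        - (JK0T L M k ⊗ₖ (1 : Matrix o o ℂ)) * (covGrad (fine (lev L k) M) ((lev L k : ℕ) : ℂ) (R k))ᴴ)
        * (calDalev L M a ha k ⊗ₖ (1 : Matrix o o ℂ))⁻¹‖
      ≤ c₀ * (d * ((L : ℝ) + 1) * Cst d a) + g * (d * ((β' + 2 * (α + β)) * Cst d a / (lev L k : ℕ))) := by
  -- `(Δ_a^{(k)} ⊗ 1)⁻¹ = 𝒢^{(k)} ⊗ 1` (`KroneckerLift.kron_inv`, `calDalev_inv`; cf. `NE2ColourPerturbedLayer.inv_calDalev_kron`)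
  rw [kron_inv, calDalev_inv]
  exact opNorm_sandwiched_divPlant_le (lev L k) L M a ha hd (one_le_lev' L k) (R₁ := R (k + 1)) (R₀ := R k) hα hβ hβ' hg hc₀ hR hLip
    hcons hGs hcomp

/-- the same with the rate displayed as a power: `…/L^k = … ·(L⁻¹)^k`. [folklore] -/
theorem planting_number_le_geom (hd : 1 ≤ d) (R : (k : ℕ) → Fin d → (Tor (fine (lev L k) M) → Matrix o o ℂ)) (k : ℕ)
    {α β β' g c₀ : ℝ} (hα : 0 ≤ α) (hβ : 0 ≤ β) (hβ' : 0 ≤ β') (hg : 0 ≤ g) (hc₀ : 0 ≤ c₀)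
    (hR : ∀ μ i, ‖connL (fine (lev L k) M) ((lev L k : ℕ) : ℂ) (R k) μ i‖ ≤ α)
    (hLip : ∀ μ lam i, ‖connL (fine (lev L k) M) ((lev L k : ℕ) : ℂ) (R k) μ (tau (fine (lev L k) M) lam i)
      - connL (fine (lev L k) M) ((lev L k : ℕ) : ℂ) (R k) μ i‖ ≤ β / (lev L k : ℕ))
    (hcons : ∀ μ (i' : Tor (fine (lev L (k + 1)) M) × Fin d),
      ‖connL (fine (lev L (k + 1)) M) ((lev L (k + 1) : ℕ) : ℂ) (R (k + 1)) μ i'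
        - connL (fine (lev L k) M) ((lev L k : ℕ) : ℂ) (R k) μ (parT (lev L k) L M i')‖ ≤ β' / (lev L k : ℕ))
    {γ' : Type*} [Fintype γ'] [DecidableEq γ'] {Gs : Matrix γ' (Tor (fine (lev L (k + 1)) M) × o) ℂ} (hGs : ‖Gs‖ ≤ g)
    (hcomp : ‖Gs * ((1 - Pi0T L M k) ⊗ₖ (1 : Matrix o o ℂ))‖ ≤ c₀) :
    ‖Gs * ((covGrad (fine (lev L (k + 1)) M) ((lev L (k + 1) : ℕ) : ℂ) (R (k + 1)))ᴴ * (JpcT L M k ⊗ₖ (1 : Matrix o o ℂ))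
        - (JK0T L M k ⊗ₖ (1 : Matrix o o ℂ)) * (covGrad (fine (lev L k) M) ((lev L k : ℕ) : ℂ) (R k))ᴴ)
        * (calDalev L M a ha k ⊗ₖ (1 : Matrix o o ℂ))⁻¹‖
      ≤ c₀ * (d * ((L : ℝ) + 1) * Cst d a) + g * (d * (β' + 2 * (α + β)) * Cst d a) * ((L : ℝ)⁻¹) ^ k := by
  refine (planting_number_le L M a ha hd R k hα hβ hβ' hg hc₀ hR hLip hcons hGs hcomp).trans (le_of_eq ?_)
  rw [cast_lev', inv_pow]
  ring

/-- tower form of `‖D_kᴴ(𝒢^{(k)} ⊗ 1)‖ ≤ dCst + dαCst` against the lifted free propagator `(Δ_a^{(k)} ⊗ 1)⁻¹`. [folklore] -/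
theorem opNorm_covGradH_mul_inv_calDalev_le (R : (k : ℕ) → Fin d → (Tor (fine (lev L k) M) → Matrix o o ℂ)) (k : ℕ) {α : ℝ}
    (hα : 0 ≤ α) (hR : ∀ μ i, ‖connL (fine (lev L k) M) ((lev L k : ℕ) : ℂ) (R k) μ i‖ ≤ α) :
    ‖(covGrad (fine (lev L k) M) ((lev L k : ℕ) : ℂ) (R k))ᴴ * (calDalev L M a ha k ⊗ₖ (1 : Matrix o o ℂ))⁻¹‖ ≤ d * Cst d a + d * α * Cst d a := by
  rw [kron_inv, calDalev_inv]; exact opNorm_covGradH_mul_calG_le (lev L k) M a ha (one_le_lev' L k) hα hR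

end Summit.QuantumFields.BalabanUV.T4Continuum.CovariantDivergencePlantingTower

end
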